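import Summits.ValiantsHypothesis.ValiantsHypothesis.Theorems.MonotoneRestorationOrbitRestorationQPDerivativeGraded
import Summits.ValiantsHypothesis.ValiantsHypothesis.Theorems.MonotoneRestorationOrbitRestorationQPDerivativeTowerWaringAlt
import Summits.ValiantsHypothesis.ValiantsHypothesis.Theorems.MonotoneRestorationOrbitRestorationQPWaringSylvesterAffine
import HarnessLib

/-!
# Affine ΣΛΣ restoration modulo the small-modules alt-spanning property

Route MonotoneRestoration, crux `OrbitRestorationQP` (stmt-ValiantsHypothesis-18293), line `depth-three-rung`,
stub A_∞ `stub_sigmaPiSigmaValue`.  Namespace `Summit.ValiantsHypothesis.ValiantsHypothesis.Theorems.DerivativeTower`.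

Depth-3 powering circuits use AFFINE forms: `f = Σ_{i<r} a_i (ℓ_{w_i} + b_i)^d` is not homogeneous.  Its
homogeneous components `f_e = Σ_i a_i b_i^{d-e} C(d,e) ℓ_{w_i}^e` are matrix-symmetric Waring expressions with
the same `r` forms; the derivative chains of all components together form a GRADED alt-supported derivative
system (`…DerivativeGraded.lean`), so the conditional ΣΛΣ rung extends to affine forms:

* `mact_homogeneousComponent` — the matrix action commutes with taking homogeneous components;
* `sigmaLambdaSigma_affine_restorable_of_smallModulesAltSupported` — **modulo the alt-spanning property
  `hKey` for matrix-stable subspaces of dimension `≤ r`, every matrix-symmetric sum of `r` scaled `d`-th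
  powers of AFFINE forms is `QPOrbitRestorable (k + 7) n f`.**

Honest label: conditional on the one representation-theoretic hypothesis; A_∞ and the crux stay open; VP ≠ VNP
untouched. [folklore]
-/

noncomputable section

open scoped Classical

-- `Summit.ValiantsHypothesis.ValiantsHypothesis.…` is the tree's single-conjunct layout (Sub = Summit).
set_option linter.dupNamespace false

namespace Summit.ValiantsHypothesis.ValiantsHypothesis.Theorems

namespace DerivativeTower

open MvPolynomial Finset Equiv OrbitRestorationQPDepthThreeRung WaringJennrich LevelStructure

variable {n : ℕ}

/-- **The matrix action commutes with homogeneous components.** [folklore] -/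
theorem mact_homogeneousComponent (σ τ : Perm (Fin n)) (f : MvPolynomial (Fin n × Fin n) ℂ) (e : ℕ) :
    mact σ τ (homogeneousComponent e f) = homogeneousComponent e (mact σ τ f) := by
  -- decompose `f` into homogeneous components and use uniqueness of the decomposition
  have hdec : f = ∑ i ∈ Finset.range (f.totalDegree + 1), homogeneousComponent i f :=
    (sum_homogeneousComponent f).symm
  have hhom : ∀ i, (mact σ τ (homogeneousComponent i f)).IsHomogeneous i := fun i => by
    rw [mact_apply]; exact (homogeneousComponent_isHomogeneous i f).rename_isHomogeneous
  conv_rhs => rw [hdec, map_sum, map_sum]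
  rw [Finset.sum_congr rfl fun i _ => homogeneousComponent_of_mem (hhom i), Finset.sum_ite_eq]
  split_ifs with h
  · rfl
  · rw [Finset.mem_range, not_lt] at h
    rw [homogeneousComponent_eq_zero e f (by omega), map_zero]

/-- **AFFINE ΣΛΣ RESTORATION MODULO THE ALT-SPANNING PROPERTY.** [folklore] -/
theorem sigmaLambdaSigma_affine_restorable_of_smallModulesAltSupported {k r d : ℕ}
    (hKey : ∀ W : Submodule ℂ (MvPolynomial (Fin n × Fin n) ℂ), FiniteDimensional ℂ W →
      Module.finrank ℂ W ≤ r → (∀ σ τ : Perm (Fin n), ∀ w ∈ W, mact σ τ w ∈ W) →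
        W ≤ Submodule.span ℂ {v | v ∈ W ∧ ∃ Y : Finset (Fin n), Y.card ≤ k ∧
          ∀ ρ : Perm (Fin n), (∀ i ∈ Y, ρ i = i) → Perm.sign ρ = 1 → ren ρ v = v})
    (w : Fin r → (Fin n × Fin n) → ℂ) (b a : Fin r → ℂ) {f : MvPolynomial (Fin n × Fin n) ℂ}
    (hf : f = ∑ i, C (a i) * (lin (w i) + C (b i)) ^ d) (hsym : ∀ σ τ : Perm (Fin n), mact σ τ f = f) :
    QPOrbitRestorable (k + 7) n f := by
  -- the homogeneous components are matrix-symmetric Waring expressions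
  set fc : ℕ → MvPolynomial (Fin n × Fin n) ℂ := fun e => homogeneousComponent e f with hfc
  have hfc_eq : ∀ e, e ≤ d → fc e = ∑ i, C (a i * (b i ^ (d - e) * (d.choose e : ℂ))) * lin (w i) ^ e := by
    intro e he
    rw [hfc]; simp only []
    rw [hf, map_sum]
    exact Finset.sum_congr rfl fun i _ => homogeneousComponent_affPow (w i) (b i) (a i) d e he
  have hfc_sym : ∀ e, ∀ σ τ : Perm (Fin n), mact σ τ (fc e) = fc e := fun e σ τ => by
    rw [hfc]; simp only []; rw [mact_homogeneousComponent, hsym]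
  -- alt-supported spanning sets for each component's derivative chain
  have hfin : ∀ e, e ≤ d → ∀ m, ∃ T : Finset (MvPolynomial (Fin n × Fin n) ℂ),
      (∀ t ∈ T, t ∈ derivChain (fc e) m ∧ ∃ Y : Finset (Fin n), Y.card ≤ k ∧
        ∀ ρ : Perm (Fin n), (∀ i ∈ Y, ρ i = i) → Perm.sign ρ = 1 → ren ρ t = t) ∧
      derivChain (fc e) m ≤ Submodule.span ℂ (T : Set _) := by
    intro e he m
    have hrk := finrank_derivChain_le w (fun i => a i * (b i ^ (d - e) * (d.choose e : ℂ))) (hfc_eq e he) m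
    haveI := hrk.1
    have hspan := hKey _ hrk.1 hrk.2 (fun σ τ v hv => mact_mem_derivChain (hfc_sym e) σ τ m hv)
    obtain ⟨S₀, hS₀⟩ := (Submodule.fg_iff_finiteDimensional _).2 hrk.1
    have hch : ∀ s ∈ S₀, ∃ F : Finset (MvPolynomial (Fin n × Fin n) ℂ),
        (↑F : Set _) ⊆ {v | v ∈ derivChain (fc e) m ∧ ∃ Y : Finset (Fin n), Y.card ≤ k ∧
          ∀ ρ : Perm (Fin n), (∀ i ∈ Y, ρ i = i) → Perm.sign ρ = 1 → ren ρ v = v} ∧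
        s ∈ Submodule.span ℂ (F : Set _) := by
      intro s hs
      have hs' : s ∈ derivChain (fc e) m := by rw [← hS₀]; exact Submodule.subset_span hs
      exact Submodule.mem_span_finite_of_mem_span (hspan hs')
    choose F hF using hch
    refine ⟨S₀.attach.biUnion fun s => F s.1 s.2, fun t ht => ?_, ?_⟩
    · obtain ⟨s, -, hts⟩ := Finset.mem_biUnion.mp ht
      exact (hF s.1 s.2).1 hts
    · rw [← hS₀, Submodule.span_le]
      intro s hs
      refine Submodule.span_mono ?_ (hF s hs).2
      intro v hv
      simp only [Finset.coe_biUnion, Finset.coe_attach, Set.mem_univ, Set.iUnion_true, Set.mem_iUnion]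
      exact ⟨⟨s, hs⟩, hv⟩
  have hfin' : ∀ e m, ∃ T : Finset (MvPolynomial (Fin n × Fin n) ℂ), e ≤ d →
      (∀ t ∈ T, t ∈ derivChain (fc e) m ∧ ∃ Y : Finset (Fin n), Y.card ≤ k ∧
        ∀ ρ : Perm (Fin n), (∀ i ∈ Y, ρ i = i) → Perm.sign ρ = 1 → ren ρ t = t) ∧
      derivChain (fc e) m ≤ Submodule.span ℂ (T : Set _) := by
    intro e m
    by_cases he : e ≤ d
    · obtain ⟨T, hT⟩ := hfin e he m; exact ⟨T, fun _ => hT⟩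
    · exact ⟨∅, fun h => (he h).elim⟩
  choose T hT using hfin'
  -- the graded system: values of degree `g` are the levels `e - g` of the chains of `fc e`, `g ≤ e ≤ d`
  let V : ℕ → Finset (MvPolynomial (Fin n × Fin n) ℂ) := fun g =>
    (Finset.range (d + 1)).biUnion fun e => if g ≤ e then T e (e - g) else ∅
  have hVmem : ∀ g t, t ∈ V g ↔ ∃ e, e ≤ d ∧ g ≤ e ∧ t ∈ T e (e - g) := by
    intro g t
    simp only [V, Finset.mem_biUnion, Finset.mem_range]
    constructor
    · rintro ⟨e, he, ht⟩
      by_cases hge : g ≤ e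
      · rw [if_pos hge] at ht; exact ⟨e, by omega, hge, ht⟩
      · rw [if_neg hge] at ht; exact absurd ht (Finset.notMem_empty t)
    · rintro ⟨e, he, hge, ht⟩
      exact ⟨e, by omega, by rw [if_pos hge]; exact ht⟩
  have hhomV : ∀ g, ∀ t ∈ V g, t.IsHomogeneous g := by
    intro g t ht
    obtain ⟨e, he, hge, ht⟩ := (hVmem g t).1 ht
    have h := isHomogeneous_of_mem_derivChain w (fun i => a i * (b i ^ (d - e) * (d.choose e : ℂ)))
      (hfc_eq e he) ((hT e (e - g) he).1 t ht).1
    rwa [show e - (e - g) = g by omega] at h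
  have hsuppV : ∀ g, ∀ t ∈ V g, ∃ Y : Finset (Fin n), Y.card ≤ k ∧
      ∀ ρ : Perm (Fin n), (∀ i ∈ Y, ρ i = i) → Perm.sign ρ = 1 → ren ρ t = t := by
    intro g t ht
    obtain ⟨e, he, _, ht⟩ := (hVmem g t).1 ht
    exact ((hT e (e - g) he).1 t ht).2
  have hderV : ∀ g, ∀ t ∈ V (g + 1), ∀ x : Fin n × Fin n,
      pderiv x t ∈ Submodule.span ℂ (V g : Set (MvPolynomial (Fin n × Fin n) ℂ)) := by
    intro g t ht x
    obtain ⟨e, he, hge, ht⟩ := (hVmem (g + 1) t).1 ht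
    have h1 : pderiv x t ∈ derivChain (fc e) (e - (g + 1) + 1) :=
      pderiv_mem_derivChain ((hT e (e - (g + 1)) he).1 t ht).1 x
    rw [show e - (g + 1) + 1 = e - g by omega] at h1
    refine Submodule.span_mono ?_ ((hT e (e - g) he).2 h1)
    intro v hv
    exact (hVmem g v).2 ⟨e, he, by omega, hv⟩
  -- `f` is the sum of its components, each a value of the system
  have hfsum : f = ∑ e ∈ Finset.range (d + 1), fc e := by
    have hdeg : f.totalDegree ≤ d := by
      rw [hf]
      refine (totalDegree_finsetSum _ _).trans (Finset.sup_le fun i _ => ?_)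
      refine (totalDegree_mul _ _).trans ?_
      rw [totalDegree_C, zero_add]
      refine (totalDegree_pow _ _).trans ?_
      have h1 : (lin (w i) + C (b i)).totalDegree ≤ 1 := by
        refine (totalDegree_add _ _).trans (max_le ?_ (by rw [totalDegree_C]; exact Nat.zero_le _))
        unfold lin
        refine (totalDegree_finsetSum _ _).trans (Finset.sup_le fun x _ => ?_)
        exact (totalDegree_mul _ _).trans (by rw [totalDegree_C, totalDegree_X, zero_add])
      exact (Nat.mul_le_mul_left d h1).trans (by rw [mul_one])
    conv_lhs => rw [← sum_homogeneousComponent f]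
    have hsub : Finset.range (f.totalDegree + 1) ⊆ Finset.range (d + 1) :=
      fun x hx => Finset.mem_range.2 (by rw [Finset.mem_range] at hx; omega)
    rw [← Finset.sum_subset hsub]
    intro e he hne
    rw [Finset.mem_range] at he hne
    show homogeneousComponent e f = 0
    exact homogeneousComponent_eq_zero e f (by omega)
  have hfspan : f ∈ Submodule.span ℂ (((Finset.range (d + 1)).biUnion V : Finset _) :
      Set (MvPolynomial (Fin n × Fin n) ℂ)) := by
    rw [hfsum]
    refine Submodule.sum_mem _ fun e he => ?_
    rw [Finset.mem_range] at he
    have h0 : fc e ∈ derivChain (fc e) 0 := mem_derivChain_zero _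
    refine Submodule.span_mono ?_ ((hT e (e - e) (by omega)).2 (by rw [Nat.sub_self]; exact h0))
    intro v hv
    rw [Finset.mem_coe, Finset.mem_biUnion]
    exact ⟨e, Finset.mem_range.2 he, (hVmem e v).2 ⟨e, by omega, le_rfl, hv⟩⟩
  exact DerivativeTowerAlt.qpOrbitRestorable_of_gradedSystem (D := d) V hhomV hsuppV hderV hfspan
    fun σ => by rw [ren_eq_mact]; exact hsym σ σ

end DerivativeTower

end Summit.ValiantsHypothesis.ValiantsHypothesis.Theorems

end
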